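import Summits.ResolutionOfSingularities.ResolutionOfSingularities.Theorems.FrobeniusClosingSteerBetaGlueSupportX
import Summits.ResolutionOfSingularities.ResolutionOfSingularities.Theorems.FrobeniusClosingSteerBetaGlueTaylor
import Summits.ResolutionOfSingularities.ResolutionOfSingularities.Theorems.FrobeniusClosingSteerBetaVertexMoves
import Summits.ResolutionOfSingularities.ResolutionOfSingularities.Theorems.FrobeniusClosingSteerBetaPreparedTransferY
import HarnessLib

/-!
# Crux `Steer` (stmt-ResolutionOfSingularities-16345), chain W4.1, β-LEAF, K-β2♭ part (III), file X2: the FRAME CORRECTION for the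
# glue `xLetterLawHat_of` — at the `x`-chart origin an attaining face-prepared frame has non-unit `x`-coefficients (def-free)

OURS (campaign `res-hironaka`, rung L ★L-G4, slot W4.1; statements about the route's own objects; they replace the
role of no printed item and are NOT statements of the manuscript under review [claim: Hironaka2017, status:
under-review]; AI review is weaker than expert review). Seat res-D-pv-003 (gen 7), K-β2♭ owner; GLUE (III) per
res-L0-w41-plan-1 RULING 276(a).

Mirror of `…BetaGlueFrame` with the roles of `x` and `y` exchanged: in a frame `(x, y, z, w)` whose minimal exponents lie in the near-point
region `A + 2B ≥ 2` of the `x`-chart origin, with cone clause `f ≡ Ψ(z, w)` (`Ψ` rootless of odd degree `d ≥ 3`), and another frame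
`z″ = z + c₁x + c₂y`, `w″ = w + c₁′x + c₂′y` in which some cleaning `f″ = f + x^a y^b q²` of order `≥ d` has NEITHER of the exponents
`(d−1, 0, 1, 0)`, `(d−1, 0, 0, 1)` (no point `(1, 0)` in slot `d − 1` — guaranteed by `DeltaGe δ` with `δ > 1` or by `DeltaFaceGe (δ, γ)` with
`γ > 0`), one has `c₁, c₁′ ∈ 𝔪` (`frame_xCoeff_mem_maximalIdeal`); so the naive `x`-chart transform `φ z″ / φ x` is again a parameter.

[cite: CossartJannsenSaito2020, Lemma 12.1 and (7.4)] [cite: CossartPiltant2019, Prop. 2.1] No Theses file is imported; nothing here is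
a route item or a registration.
-/

noncomputable section

-- `Summit.<S>.<S>.…` duplicates the summit name by design (single-problem summit).
set_option linter.dupNamespace false

namespace Summit.ResolutionOfSingularities.ResolutionOfSingularities.Theorems.SwitchingDichotomy.BetaNewton

open IsLocalRing MvPolynomial
open Literature.AlgebraicGeometry.Resolution
open Literature.AlgebraicGeometry.Resolution.CossartPiltant (uPow uPow_mem_span_uPow uPow_mem_span_uPow_of_le minExponents
  uPow_add uPow_single exists_expansion_minExponents coeff_not_mem_of_minimal mem_span_range_of_mul_uPow_mem)
open Summit.ResolutionOfSingularities.ResolutionOfSingularities.Theorems.SwitchingDichotomy.BetaPolygon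
open Summit.ResolutionOfSingularities.ResolutionOfSingularities.Theorems.SwitchingDichotomy.BetaLetter
  (uPow_four range_four span_four_pow_eq_span_uPow)

variable {S : Type} [CommRing S]

/-! ## §1 The engine with a general shift element -/

/-- **Engine (general shift element).** Same as `dir_pderiv_eval_mem_maximalIdeal` of `…BetaGlueFrame` with the shift variable `y`
replaced by an arbitrary element `sh` (`t′^{e⋆} = sh^(d−1)·p`, `sh^d ∈ E`, `z ≡ −c·sh + p·δ₀`, `w ≡ −c′·sh + p·δ₁` modulo the monomial
ideal `E` of the exponents not below `e⋆`): then `δ₀ ∂₀Ψ(−c, −c′) + δ₁ ∂₁Ψ(−c, −c′) ∈ 𝔪`. The `x`-letter uses `sh = x`. [folklore] -/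
theorem dir_pderiv_eval_mem_maximalIdeal' [IsLocalRing S] {x y z' w' : S} (ht' : IsRsopPart ![x, y, z', w'])
    (hspan' : Ideal.span {x, y, z', w'} = maximalIdeal S) {d : ℕ} {Ψ : MvPolynomial (Fin 2) S}
    (hΨ : Ψ.IsHomogeneous d) {estar : Fin 4 → ℕ} {p sh : S} (hue : uPow ![x, y, z', w'] estar = sh ^ (d - 1) * p)
    (hpp : p * p ∈ Ideal.span (uPow ![x, y, z', w'] '' {e | ¬ e ≤ estar}))
    (hyd : sh ^ d ∈ Ideal.span (uPow ![x, y, z', w'] '' {e | ¬ e ≤ estar})) {c₂ c₂' z w : S} (δ : Fin 2 → S)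
    (hz : z - (-(c₂ * sh) + p * δ 0) ∈ Ideal.span (uPow ![x, y, z', w'] '' {e | ¬ e ≤ estar}))
    (hw : w - (-(c₂' * sh) + p * δ 1) ∈ Ideal.span (uPow ![x, y, z', w'] '' {e | ¬ e ≤ estar}))
    (hmem : eval ![z, w] Ψ ∈ Ideal.span (uPow ![x, y, z', w'] '' {e | ¬ e ≤ estar})) :
    δ 0 * eval ![-c₂, -c₂'] (pderiv 0 Ψ) + δ 1 * eval ![-c₂, -c₂'] (pderiv 1 Ψ) ∈ maximalIdeal S := by
  classical
  set E : Ideal S := Ideal.span (uPow ![x, y, z', w'] '' {e | ¬ e ≤ estar}) with hE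
  set D : S := δ 0 * eval ![-c₂, -c₂'] (pderiv 0 Ψ) + δ 1 * eval ![-c₂, -c₂'] (pderiv 1 Ψ) with hD
  set mk : S →+* S ⧸ E := Ideal.Quotient.mk E with hmk
  have hmk0 : ∀ s ∈ E, mk s = 0 := fun s hs => Ideal.Quotient.eq_zero_iff_mem.mpr hs
  have hu : mk p * mk p = 0 := by rw [← map_mul]; exact hmk0 _ hpp
  have hy0 : mk sh ^ d = 0 := by rw [← map_pow]; exact hmk0 _ hyd
  -- the point `(z, w)` modulo `E`
  have hptZ : mk z = mk sh * mk (-c₂) + mk p * mk (δ 0) := by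
    have h := (Ideal.Quotient.mk_eq_mk_iff_sub_mem _ _).mpr hz
    rw [← hmk] at h
    rw [h, map_add, map_neg, map_mul, map_mul, map_neg]; ring
  have hptW : mk w = mk sh * mk (-c₂') + mk p * mk (δ 1) := by
    have h := (Ideal.Quotient.mk_eq_mk_iff_sub_mem _ _).mpr hw
    rw [← hmk] at h
    rw [h, map_add, map_neg, map_mul, map_mul, map_neg]; ring
  have hpt : mk ∘ ![z, w] = (mk sh) • ![mk (-c₂), mk (-c₂')] + mk p • ![mk (δ 0), mk (δ 1)] := by
    funext j
    fin_cases j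
    · simp [hptZ]
    · simp [hptW]
  -- evaluate modulo `E`
  have hderiv : ∀ i : Fin 2, eval ((mk sh) • ![mk (-c₂), mk (-c₂')]) (pderiv i (MvPolynomial.map mk Ψ)) =
      mk sh ^ (d - 1) * mk (eval ![-c₂, -c₂'] (pderiv i Ψ)) := by
    intro i
    rw [eval_smul_of_isHomogeneous ((hΨ.map mk).pderiv), map_eval mk ![-c₂, -c₂'] (pderiv i Ψ), pderiv_map]
    have hcomp : mk ∘ ![-c₂, -c₂'] = ![mk (-c₂), mk (-c₂')] := by funext j; fin_cases j <;> rfl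
    rw [hcomp]
  have key : mk (eval ![z, w] Ψ) = mk (p * sh ^ (d - 1) * D) := by
    rw [map_eval mk ![z, w] Ψ, hpt, eval_add_smul_of_mul_self_eq_zero _ _ _ hu, eval_smul_of_isHomogeneous (hΨ.map mk),
      hy0, zero_mul, zero_add]
    simp only [Matrix.cons_val_zero, Matrix.cons_val_one]
    rw [hderiv 0, hderiv 1, hD, map_mul, map_mul, map_pow, map_add, map_mul, map_mul]
    ring
  -- lift back: `D · sh^(d−1) · p ∈ E`
  have hprod : D * uPow ![x, y, z', w'] estar ∈ E := by
    rw [hue, ← Ideal.Quotient.eq_zero_iff_mem, ← hmk, map_mul]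
    have h0 : mk (eval ![z, w] Ψ) = 0 := hmk0 _ hmem
    rw [key, map_mul] at h0
    rw [mul_comm, mul_comm (sh ^ (d - 1)) p]; exact h0
  have := mem_span_range_of_mul_uPow_mem ![x, y, z', w'] ht'.mem_span_image_of_mul_mem
    (fun b hb hle => (show ¬ b ≤ estar from hb) hle) hprod
  rwa [range_four, hspan'] at this

/-! ## §2 The cone clause in an `x`-near frame: `f − Ψ(z, w) ∈ (y) + 𝔪^(d+1)` -/

/-- **In an `x`-near frame the cone clause sharpens to `f − Ψ(z, w) ∈ (y) + 𝔪^(d+1)`.** [folklore] -/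
theorem sub_cone_mem_of_nearX [IsLocalRing S] {x y z w : S} (ht : IsRsopPart ![x, y, z, w])
    (hspan : Ideal.span {x, y, z, w} = maximalIdeal S) {d : ℕ} (hd : 0 < d) {Ψ : MvPolynomial (Fin 2) S}
    (hΨ : Ψ.IsHomogeneous d) {f : S}
    (hfΨ : f - eval ![z, w] Ψ ∈ Ideal.span {x, y} * maximalIdeal S ^ (d - 1) ⊔ maximalIdeal S ^ (d + 1))
    (hnear : ∀ a ∈ minExponents ![x, y, z, w] f, 2 * d ≤ a 0 + 2 * a 1 + 2 * a 2 + 2 * a 3) :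
    f - eval ![z, w] Ψ ∈ Ideal.span {y} ⊔ maximalIdeal S ^ (d + 1) := by
  set T := f - eval ![z, w] Ψ with hT
  have hTG : T ∈ Ideal.span (uPow ![x, y, z, w] '' {e | 2 * d ≤ e 0 + 2 * e 1 + 2 * e 2 + 2 * e 3}) := by
    refine sub_mem (mem_of_forall_minExponents_uPow_mem ht fun c hc => uPow_mem_span_uPow _ (hnear c hc)) ?_
    refine Ideal.span_mono (Set.image_mono fun e he => ?_) (eval_mem_span_uPow_of_isHomogeneous x y z w hΨ)
    simp only [Set.mem_setOf_eq] at he ⊢; omega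
  have hTK : T ∈ Ideal.span (uPow ![x, y, z, w] ''
      {e | d + 1 ≤ ∑ l, e l ∨ (d ≤ ∑ l, e l ∧ (1 ≤ e 0 ∨ 1 ≤ e 1))}) := by
    have hK : Ideal.span {x, y} * maximalIdeal S ^ (d - 1) ⊔ maximalIdeal S ^ (d + 1) ≤
        Ideal.span (uPow ![x, y, z, w] '' {e | d + 1 ≤ ∑ l, e l ∨ (d ≤ ∑ l, e l ∧ (1 ≤ e 0 ∨ 1 ≤ e 1))}) := by
      refine sup_le ?_ ?_
      · rw [← hspan, span_four_pow_eq_span_uPow, Ideal.span_mul_span', Ideal.span_le]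
        rintro _ ⟨s, hs, _, ⟨e, he, rfl⟩, rfl⟩
        simp only [Set.mem_setOf_eq] at he
        show s * uPow ![x, y, z, w] e ∈ _
        simp only [Set.mem_insert_iff, Set.mem_singleton_iff] at hs
        rcases hs with hs | hs
        · have : s * uPow ![x, y, z, w] e = uPow ![x, y, z, w] (e + Pi.single 0 1) := by
            rw [uPow_add, uPow_single, mul_comm, hs]; rfl
          rw [this]
          refine uPow_mem_span_uPow _ (Or.inr ⟨?_, Or.inl ?_⟩)
          · rw [sum_four] at he ⊢; simp; omega
          · simp
        · have : s * uPow ![x, y, z, w] e = uPow ![x, y, z, w] (e + Pi.single 1 1) := by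
            rw [uPow_add, uPow_single, mul_comm, hs]; rfl
          rw [this]
          refine uPow_mem_span_uPow _ (Or.inr ⟨?_, Or.inr ?_⟩)
          · rw [sum_four] at he ⊢; simp; omega
          · simp
      · rw [← hspan, span_four_pow_eq_span_uPow]
        exact Ideal.span_mono (Set.image_mono fun e he => Or.inl he)
    exact hK hfΨ
  refine mem_of_forall_minExponents_uPow_mem ht fun e he => ?_
  obtain ⟨g, hg, hge⟩ := exists_le_of_mem_span_uPow ht hTG he
  obtain ⟨k, hk, hke⟩ := exists_le_of_mem_span_uPow ht hTK he
  simp only [Set.mem_setOf_eq] at hg hk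
  have g0 : g 0 ≤ e 0 := hge 0; have g1 : g 1 ≤ e 1 := hge 1; have g2 : g 2 ≤ e 2 := hge 2; have g3 : g 3 ≤ e 3 := hge 3
  have k0 : k 0 ≤ e 0 := hke 0; have k1 : k 1 ≤ e 1 := hke 1; have k2 : k 2 ≤ e 2 := hke 2; have k3 : k 3 ≤ e 3 := hke 3
  rw [sum_four] at hk
  by_cases h1 : 1 ≤ e 1
  · refine Ideal.mem_sup_left (Ideal.mem_span_singleton'.mpr ⟨uPow ![x, y, z, w] (e - Pi.single 1 1), ?_⟩)
    have : e = (e - Pi.single 1 1) + Pi.single 1 1 := by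
      funext l
      obtain rfl | rfl | rfl | rfl : l = 0 ∨ l = 1 ∨ l = 2 ∨ l = 3 := by fin_cases l <;> simp
      · simp
      · simp; omega
      all_goals simp
    conv_rhs => rw [this, uPow_add, uPow_single]
    simp [mul_comm]
  · refine Ideal.mem_sup_right ?_
    have hdeg : d + 1 ≤ ∑ l, e l := by rw [sum_four]; omega
    exact Ideal.pow_le_pow_right hdeg (uPow_mem_maximalIdeal_pow hspan e)

/-! ## §3 The frame correction at the `x`-chart origin -/

/-- The common membership step: `Ψ(z, w)` lies in the monomial ideal of the exponents not below `e⋆ ∈ {(d−1,0,1,0), (d−1,0,0,1)}`, provided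
the cleaned element `f″` does not have `e⋆` as a minimal exponent. [folklore] -/
theorem eval_cone_mem_span_uPow_not_le_X [IsLocalRing S] [CharP S 2] {x y z w z' w' : S} (ht : IsRsopPart ![x, y, z, w])
    (ht' : IsRsopPart ![x, y, z', w']) (hspan : Ideal.span {x, y, z, w} = maximalIdeal S)
    (hspan' : Ideal.span {x, y, z', w'} = maximalIdeal S) {d : ℕ} (h3 : 3 ≤ d) {Ψ : MvPolynomial (Fin 2) S}
    (hΨ : Ψ.IsHomogeneous d) {f : S}
    (hfΨ : f - eval ![z, w] Ψ ∈ Ideal.span {x, y} * maximalIdeal S ^ (d - 1) ⊔ maximalIdeal S ^ (d + 1))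
    (hnear : ∀ a ∈ minExponents ![x, y, z, w] f, 2 * d ≤ a 0 + 2 * a 1 + 2 * a 2 + 2 * a 3)
    {a b : ℕ} {q : S} (hfd' : f + x ^ a * y ^ b * q ^ 2 ∈ maximalIdeal S ^ d) {estar : Fin 4 → ℕ}
    (hst : ∀ e : Fin 4 → ℕ, e ≤ estar → e 1 = 0 ∧ e 0 ≤ d - 1 ∧ e 2 + e 3 ≤ 1)
    (hnot : ∀ e ∈ minExponents ![x, y, z', w'] (f + x ^ a * y ^ b * q ^ 2), ¬ e ≤ estar) :
    eval ![z, w] Ψ ∈ Ideal.span (uPow ![x, y, z', w'] '' {e | ¬ e ≤ estar}) := by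
  classical
  have hd : 0 < d := by omega
  have hfd : f ∈ maximalIdeal S ^ d := mem_pow_of_cone hspan hd hΨ hfΨ
  have hT := sub_cone_mem_of_nearX ht hspan hd hΨ hfΨ hnear
  have huq : x ^ a * y ^ b * q ^ 2 ∈ maximalIdeal S ^ d := by
    have : x ^ a * y ^ b * q ^ 2 = (f + x ^ a * y ^ b * q ^ 2) - f := by ring
    rw [this]; exact sub_mem hfd' hfd
  have hdeg : ∀ e : Fin 4 → ℕ, d + 1 ≤ ∑ l, e l → ¬ e ≤ estar := by
    intro e he hle
    obtain ⟨h0, h1, h23⟩ := hst e hle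
    rw [sum_four] at he; omega
  have hy1 : ∀ e : Fin 4 → ℕ, 1 ≤ e 1 → ¬ e ≤ estar := by
    intro e he hle
    obtain ⟨h0, -, -⟩ := hst e hle
    omega
  have hTE : f - eval ![z, w] Ψ ∈ Ideal.span (uPow ![x, y, z', w'] '' {e | ¬ e ≤ estar}) := by
    have hle : Ideal.span {y} ⊔ maximalIdeal S ^ (d + 1) ≤ Ideal.span (uPow ![x, y, z', w'] '' {e | ¬ e ≤ estar}) := by
      refine sup_le ?_ ?_
      · rw [Ideal.span_singleton_le_iff_mem]
        have h := uPow_mem_span_uPow ![x, y, z', w'] (B := {e | ¬ e ≤ estar}) (b := Pi.single 1 1)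
          (hy1 (Pi.single 1 1) (by rw [Pi.single_eq_same]))
        simpa [uPow_single] using h
      · rw [← hspan', span_four_pow_eq_span_uPow]
        exact Ideal.span_mono (Set.image_mono fun e he => hdeg e he)
    exact hle hT
  have hf'E : f + x ^ a * y ^ b * q ^ 2 ∈ Ideal.span (uPow ![x, y, z', w'] '' {e | ¬ e ≤ estar}) :=
    mem_of_forall_minExponents_uPow_mem ht' fun e he => uPow_mem_span_uPow _ (hnot e he)
  have huqE : x ^ a * y ^ b * q ^ 2 ∈ Ideal.span (uPow ![x, y, z', w'] '' {e | ¬ e ≤ estar}) := by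
    obtain ⟨hQ, hqQ, hminQ⟩ := ht'.minExponents_spec q
    obtain ⟨η, hηq⟩ := exists_expansion_minExponents ![x, y, z', w'] hqQ
    have hηu := coeff_not_mem_of_minimal _ hQ hminQ hηq
    have hε : uPow ![x, y, z', w'] ![a, b, 0, 0] = x ^ a * y ^ b := by rw [uPow_four]; simp
    have hexp : x ^ a * y ^ b * q ^ 2 =
        ∑ c ∈ minExponents ![x, y, z', w'] q, η c ^ 2 * uPow ![x, y, z', w'] (2 • c + ![a, b, 0, 0]) := by
      have h2 := mul_sq_expansion ![x, y, z', w'] (minExponents ![x, y, z', w'] q) η id ![a, b, 0, 0]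
      simp only [id] at h2
      rw [← h2, ← hηq, hε]
    refine mem_of_forall_minExponents_uPow_mem ht' fun e he => uPow_mem_span_uPow _ ?_
    have hdege := (mem_pow_iff_forall_minExponents ht' hspan' d _).mp huq e he
    rw [hexp] at he
    obtain ⟨c, -, rfl⟩ := forall_minExponents_sum_sq ht' _ hηu ![a, b, 0, 0] _ he
    intro hle
    obtain ⟨h0, h1, h23⟩ := hst _ hle
    rw [sum_four] at hdege
    simp only [Pi.add_apply, Pi.smul_apply, smul_eq_mul, Matrix.cons_val_zero, Matrix.cons_val_one,
      Matrix.cons_val] at h0 h1 h23 hdege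
    omega
  have : eval ![z, w] Ψ = (f + x ^ a * y ^ b * q ^ 2) - x ^ a * y ^ b * q ^ 2 - (f - eval ![z, w] Ψ) := by ring
  rw [this]
  exact sub_mem (sub_mem hf'E huqE) hTE

/-- **FRAME CORRECTION at the `x`-chart origin.** In an `x`-near frame `(x, y, z, w)` with cone clause `f ≡ Ψ(z, w)` (`Ψ` homogeneous
of ODD degree `d ≥ 3`, rootless), characteristic `2`: if in the frame `z″ = z + c₁x + c₂y`, `w″ = w + c₁′x + c₂′y` some cleaning
`f + x^a y^b q²` of order `≥ d` has neither `(d−1,0,1,0)` nor `(d−1,0,0,1)` as a minimal exponent, then `c₁, c₁′ ∈ 𝔪`.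
[cite: CossartJannsenSaito2020, Lemma 12.1 and (7.4)] -/
theorem frame_xCoeff_mem_maximalIdeal [IsLocalRing S] [CharP S 2] (hreg : IsRegularLocalRing S) (hdim : ringKrullDim S = 4)
    {x y z w : S} (hspan : Ideal.span {x, y, z, w} = maximalIdeal S) {d : ℕ} (hodd : Odd d) (h3 : 3 ≤ d)
    {Ψ : MvPolynomial (Fin 2) S} (hΨ : Ψ.IsHomogeneous d)
    (hroot : ∀ a b : ResidueField S, (a ≠ 0 ∨ b ≠ 0) → eval ![a, b] (MvPolynomial.map (residue S) Ψ) ≠ 0)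
    {f : S} (hfΨ : f - eval ![z, w] Ψ ∈ Ideal.span {x, y} * maximalIdeal S ^ (d - 1) ⊔ maximalIdeal S ^ (d + 1))
    (hnear : ∀ a ∈ minExponents ![x, y, z, w] f, 2 * d ≤ a 0 + 2 * a 1 + 2 * a 2 + 2 * a 3)
    {z' w' c₁ c₂ c₁' c₂' : S} (hz' : z' = z + c₁ * x + c₂ * y) (hw' : w' = w + c₁' * x + c₂' * y)
    {a b : ℕ} {q : S} (hfd' : f + x ^ a * y ^ b * q ^ 2 ∈ maximalIdeal S ^ d)
    (hno2 : (![d - 1, 0, 1, 0] : Fin 4 → ℕ) ∉ minExponents ![x, y, z', w'] (f + x ^ a * y ^ b * q ^ 2))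
    (hno3 : (![d - 1, 0, 0, 1] : Fin 4 → ℕ) ∉ minExponents ![x, y, z', w'] (f + x ^ a * y ^ b * q ^ 2)) :
    c₁ ∈ maximalIdeal S ∧ c₁' ∈ maximalIdeal S := by
  classical
  haveI := hreg
  have hxy : ∀ c c' : S, c * x + c' * y ∈ Ideal.span ({x, y} : Set S) := fun c c' =>
    add_mem (Ideal.mul_mem_left _ _ (Ideal.subset_span (by simp))) (Ideal.mul_mem_left _ _ (Ideal.subset_span (by simp)))
  have hspan' : Ideal.span {x, y, z', w'} = maximalIdeal S := by
    rw [hz', hw', add_assoc, add_assoc, span_four_move_eq x y z w (hxy c₁ c₂) (hxy c₁' c₂'), hspan]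
  have ht : IsRsopPart ![x, y, z, w] := isRsopPart_four hreg hdim hspan
  have ht' : IsRsopPart ![x, y, z', w'] := isRsopPart_four hreg hdim hspan'
  have hfdq := (mem_pow_iff_forall_minExponents ht' hspan' d _).mp hfd'
  -- generic memberships in the frame `t′`
  have hmemE : ∀ (estar b' : Fin 4 → ℕ), ¬ b' ≤ estar →
      uPow ![x, y, z', w'] b' ∈ Ideal.span (uPow ![x, y, z', w'] '' {e | ¬ e ≤ estar}) :=
    fun estar b' hb' => uPow_mem_span_uPow ![x, y, z', w'] (B := {e | ¬ e ≤ estar}) (b := b') hb'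
  -- «not a minimal exponent» ⇒ «no minimal exponent below e⋆»
  have hnot : ∀ estar : Fin 4 → ℕ, estar ∉ minExponents ![x, y, z', w'] (f + x ^ a * y ^ b * q ^ 2) →
      (∀ e : Fin 4 → ℕ, e ≤ estar → e 1 = 0 ∧ e 0 ≤ d - 1 ∧ e 2 + e 3 ≤ 1) → (∑ l, estar l = d) →
      (estar 2 ≤ 1 ∧ estar 3 ≤ 1) →
      ∀ e ∈ minExponents ![x, y, z', w'] (f + x ^ a * y ^ b * q ^ 2), ¬ e ≤ estar := by
    intro estar hno hst hsum h23 e he hle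
    have hdege := hfdq e he
    obtain ⟨h1, h0, h23'⟩ := hst e hle
    have k0 : e 0 ≤ estar 0 := hle 0; have k2 : e 2 ≤ estar 2 := hle 2; have k3 : e 3 ≤ estar 3 := hle 3
    rw [sum_four] at hdege hsum
    have heq : e = estar := by
      funext l
      obtain rfl | rfl | rfl | rfl : l = 0 ∨ l = 1 ∨ l = 2 ∨ l = 3 := by fin_cases l <;> simp
      all_goals omega
    exact hno (heq ▸ he)
  -- the two first-order coefficients lie in `𝔪`
  have hA : eval ![-c₁, -c₁'] (pderiv 0 Ψ) ∈ maximalIdeal S := by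
    have hst : ∀ e : Fin 4 → ℕ, e ≤ ![d - 1, 0, 1, 0] → e 1 = 0 ∧ e 0 ≤ d - 1 ∧ e 2 + e 3 ≤ 1 := by
      intro e hle
      have h0 := hle 0; have h1 := hle 1; have h2 := hle 2; have h3' := hle 3
      simp at h0 h1 h2 h3'; omega
    have hmem := eval_cone_mem_span_uPow_not_le_X ht ht' hspan hspan' h3 hΨ hfΨ hnear hfd' hst
      (hnot _ hno2 hst (by simp [sum_four]; omega) (by simp))
    have := dir_pderiv_eval_mem_maximalIdeal' ht' hspan' hΨ (estar := ![d - 1, 0, 1, 0]) (p := z') (sh := x)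
      (by rw [uPow_four]; simp) (by
        have h := hmemE ![d - 1, 0, 1, 0] (Pi.single 2 1 + Pi.single 2 1) (by intro hle; have := hle 2; simp at this)
        rwa [uPow_add, uPow_single] at h)
      (by simpa [uPow_four] using hmemE _ (Pi.single 0 d) (by intro hle; have := hle 0; simp at this; omega))
      ![1, 0] (z := z) (w := w) (c₂ := c₁) (c₂' := c₁') ?_ ?_ hmem
    · simpa using this
    · have : z - (-(c₁ * x) + z' * (![1, 0] : Fin 2 → S) 0) = -(c₂ * y) := by simp [hz']; ring
      rw [this]
      exact neg_mem (Ideal.mul_mem_left _ _ (by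
        simpa [uPow_single] using hmemE _ (Pi.single 1 1) (by intro hle; have := hle 1; simp at this)))
    · have : w - (-(c₁' * x) + z' * (![1, 0] : Fin 2 → S) 1) = w' - c₂' * y := by simp [hw']
      rw [this]
      exact sub_mem (by simpa [uPow_single] using hmemE _ (Pi.single 3 1) (by intro hle; have := hle 3; simp at this))
        (Ideal.mul_mem_left _ _ (by
          simpa [uPow_single] using hmemE _ (Pi.single 1 1) (by intro hle; have := hle 1; simp at this)))
  have hBc : eval ![-c₁, -c₁'] (pderiv 1 Ψ) ∈ maximalIdeal S := by
    have hst : ∀ e : Fin 4 → ℕ, e ≤ ![d - 1, 0, 0, 1] → e 1 = 0 ∧ e 0 ≤ d - 1 ∧ e 2 + e 3 ≤ 1 := by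
      intro e hle
      have h0 := hle 0; have h1 := hle 1; have h2 := hle 2; have h3' := hle 3
      simp at h0 h1 h2 h3'; omega
    have hmem := eval_cone_mem_span_uPow_not_le_X ht ht' hspan hspan' h3 hΨ hfΨ hnear hfd' hst
      (hnot _ hno3 hst (by simp [sum_four]; omega) (by simp))
    have := dir_pderiv_eval_mem_maximalIdeal' ht' hspan' hΨ (estar := ![d - 1, 0, 0, 1]) (p := w') (sh := x)
      (by rw [uPow_four]; simp) (by
        have h := hmemE ![d - 1, 0, 0, 1] (Pi.single 3 1 + Pi.single 3 1) (by intro hle; have := hle 3; simp at this)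
        rwa [uPow_add, uPow_single] at h)
      (by simpa [uPow_four] using hmemE _ (Pi.single 0 d) (by intro hle; have := hle 0; simp at this; omega))
      ![0, 1] (z := z) (w := w) (c₂ := c₁) (c₂' := c₁') ?_ ?_ hmem
    · simpa using this
    · have : z - (-(c₁ * x) + w' * (![0, 1] : Fin 2 → S) 0) = z' - c₂ * y := by simp [hz']
      rw [this]
      exact sub_mem (by simpa [uPow_single] using hmemE _ (Pi.single 2 1) (by intro hle; have := hle 2; simp at this))
        (Ideal.mul_mem_left _ _ (by
          simpa [uPow_single] using hmemE _ (Pi.single 1 1) (by intro hle; have := hle 1; simp at this)))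
    · have : w - (-(c₁' * x) + w' * (![0, 1] : Fin 2 → S) 1) = -(c₂' * y) := by simp [hw']; ring
      rw [this]
      exact neg_mem (Ideal.mul_mem_left _ _ (by
        simpa [uPow_single] using hmemE _ (Pi.single 1 1) (by intro hle; have := hle 1; simp at this)))
  -- Euler and rootlessness
  have hΨm : eval ![-c₁, -c₁'] Ψ ∈ maximalIdeal S := by
    have heu := euler_eval hΨ ![-c₁, -c₁']
    have hd1 : (d : S) = 1 := by
      obtain ⟨k, rfl⟩ := hodd
      have h2 : (2 : S) = 0 := by simpa using CharP.cast_eq_zero S 2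
      push_cast; rw [h2]; ring
    rw [hd1, one_mul] at heu
    rw [← heu]
    exact add_mem (Ideal.mul_mem_left _ _ hA) (Ideal.mul_mem_left _ _ hBc)
  have hres : eval ![residue S (-c₁), residue S (-c₁')] (MvPolynomial.map (residue S) Ψ) = 0 := by
    have := map_eval (residue S) ![-c₁, -c₁'] Ψ
    have hcomp : (residue S) ∘ ![-c₁, -c₁'] = ![residue S (-c₁), residue S (-c₁')] := by
      funext j; fin_cases j <;> rfl
    rw [hcomp] at this
    rw [← this, residue_eq_zero_iff]
    exact hΨm
  by_contra hne
  have : residue S (-c₁) ≠ 0 ∨ residue S (-c₁') ≠ 0 := by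
    by_contra h
    push Not at h
    apply hne
    constructor
    · have := (residue_eq_zero_iff _).mp h.1; simpa using this
    · have := (residue_eq_zero_iff _).mp h.2; simpa using this
  exact hroot _ _ this hres

end Summit.ResolutionOfSingularities.ResolutionOfSingularities.Theorems.SwitchingDichotomy.BetaNewton

end
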